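import Summits.PneNP.PneNP.Theorems.NegLimitedCliqueLikeNegLimitedLog

/-!
# Route NegLimited — T1q / T3: the quasi-polynomial form and the single-output negation-limited gap at budget `Θ(log v / log log v)` (rung F-N1/p3)

* `cliqueLikeNegLimitedLogQuasi` (**T1q**): size `≥ 2^{⌊log₂ m⌋²}` at the NOT budget `logBudget m`
  for every `(⌊√m⌋-1, ⌊√m⌋)`-clique-like function, eventually in `m` (same induction, general
  size bound `N`, parameters `l = L²`, `r = L²+1+(L+1)L²`, `c = 4r²`, threshold `K ≥ 9`).
* **T3** `negationLimitedGapSingleOutputLog_holds`: the single-output negation-limited gap in the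
  shape of the tree's barrier record `Literature.Barriers.PneNP.NegationLimitedGapSingleOutputSqrtLog`
  at budget `Θ(log v / log log v)` — the tree's `cliqueLike_generic_bound_gap` applied to the
  discharged Tardos fact and T1.
Cell record: HOME/pnp-ideate-p3/PortNegLimLog.lean (referee PASS).
-/

set_option linter.dupNamespace false -- `Summit.PneNP.PneNP.…`: summit = sub-problem name (D-0017 single-conjunct layout)

namespace Summit.PneNP.PneNP.Theorems.NegLimLog

open Finset Literature.Computability.Complexity Literature.Computability.Complexity.GateList
  Literature.Computability.Complexity.Razborov

variable {m : ℕ}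

/-! ### T1q: the quasi-polynomial form — size `≥ 2^{⌊log₂ m⌋²}` at the same NOT budget

Same induction with a general size bound `N` in place of `m^k`, and the parameters `l = L²`,
`r = L² + 1 + (L+1) L²`, `c = 4 r²` (`log₂ c ≤ 6K + 14 ≤ 7 (K+1)`), threshold `K ≥ 9`. -/

/-- `le_size_of_cliqueLike_ab` with a general size bound `N`. -/
theorem le_size_of_cliqueLike_abN {m s N R c l r : ℕ} (hr : 2 ≤ r) (hl : 2 ≤ l) (hls : l < s)
    (h4 : 4 * (r - 1) ≤ c)
    (hA : (N + 2 * R + 2) * (m + 1) ^ l * (l ^ 2) ^ r < c ^ r)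
    (hB : 2 * ((N + 2 * R + 2) * ((r - 1) ^ l) ^ 2) < c ^ (l + 1))
    (hsm : s ≤ m / c ^ (R + 1)) (hRs : (R + 1) * c ≤ s - 1)
    (F : (KEdge m → Bool) → Bool) (hCL : CliqueLike (univ : Finset (Fin m)) (s - 1) s F)
    (C : Circuit (KEdge m)) (hC : C.IsOver deMorganBasis)
    (hcomp : C.Computes F) (hneg : C.negationCount ≤ R) : N ≤ C.size := by
  by_contra hlt
  push Not at hlt
  refine cliqueLike_induction_ab (m := m) (T := N + 2 * R) hr hl hls h4 hA hB R C.gates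
    C.output univ (s - 1) F (wf_gates C)
    (fun g hg => deMorganBasis_subset_deMorganBasis01 (hC g hg)) C.wf_output
    (by rw [← circuit_negationCount]; exact hneg) (fun x => by rw [← circuit_eval]; exact hcomp x)
    hCL ?_ ?_ hRs
  · have : C.gates.length = C.size := rfl
    omega
  · simpa using hsm

/-- Quasi-polynomial regime: `l = L²`. -/
def ql (L : ℕ) : ℕ := L ^ 2

/-- Quasi-polynomial regime: `r = L² + 1 + (L+1) L²`. -/
def qr (L : ℕ) : ℕ := L ^ 2 + 1 + (L + 1) * ql L

/-- Quasi-polynomial regime: `c = 4 r²`. -/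
def qc (L : ℕ) : ℕ := 4 * qr L ^ 2

/-- Closed form of the quasi-polynomial parameter `r`: `qr L = L²(L+2)+1`. -/
theorem qr_eq (L : ℕ) : qr L = L ^ 2 * (L + 2) + 1 := by
  unfold qr ql; ring

/-- `ql L < qr L`. -/
theorem ql_lt_qr (L : ℕ) : ql L < qr L := by
  unfold qr ql; omega

/-- `2 ≤ qr L` once `1 ≤ L`. -/
theorem two_le_qr {L : ℕ} (hL : 1 ≤ L) : 2 ≤ qr L := by
  have : 1 ≤ L ^ 2 := Nat.one_le_pow _ _ hL
  unfold qr ql; omega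

/-- `qr L ≤ qc L`. -/
theorem qr_le_qc (L : ℕ) : qr L ≤ qc L := by
  unfold qc; nlinarith [Nat.zero_le (qr L)]

/-- `40 K + 100 ≤ 2^K` for `K ≥ 9`. -/
theorem forty_mul_add_le_two_pow {K : ℕ} (hK : 9 ≤ K) : 40 * K + 100 ≤ 2 ^ K := by
  induction K, hK using Nat.le_induction with
  | base => norm_num
  | succ K hK ih =>
    have h40 : 40 ≤ 2 ^ K := le_trans (by norm_num) (Nat.pow_le_pow_right (by norm_num) hK)
    rw [pow_succ]
    omega

/-- `c ≤ 2^(6K + 14)` whenever `L < 2^(K+1)`. -/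
theorem qc_le_two_pow {L K : ℕ} (hLK : L < 2 ^ (K + 1)) : qc L ≤ 2 ^ (6 * K + 14) := by
  have hL2 : L + 2 ≤ 2 ^ (K + 2) := by rw [pow_succ]; omega
  have hr : qr L ≤ (2 ^ (K + 2)) ^ 3 := by
    rw [qr_eq]
    calc L ^ 2 * (L + 2) + 1 ≤ (L + 2) ^ 3 := by nlinarith [Nat.zero_le L]
      _ ≤ (2 ^ (K + 2)) ^ 3 := Nat.pow_le_pow_left hL2 3
  unfold qc
  calc 4 * qr L ^ 2 ≤ 4 * ((2 ^ (K + 2)) ^ 3) ^ 2 := by gcongr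
    _ = 2 ^ (6 * K + 14) := by
        rw [← pow_mul, ← pow_mul, show (4 : ℕ) = 2 ^ 2 by norm_num, ← pow_add]
        congr 1; ring

/-- **The side conditions in the quasi-polynomial regime**, `N = 2^{L²}`, threshold `K ≥ 9`. -/
theorem params_ok_quasi {m L K R : ℕ} (hLm : Nat.log 2 m = L) (hKL : Nat.log 2 L = K)
    (hRd : R = L / (20 * (K + 1))) (hK : 9 ≤ K) :
    2 ≤ qr L ∧ 2 ≤ ql L ∧ ql L < Nat.sqrt m ∧ 4 * (qr L - 1) ≤ qc L ∧
    (2 ^ L ^ 2 + 2 * R + 2) * (m + 1) ^ ql L * (ql L ^ 2) ^ qr L < qc L ^ qr L ∧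
    2 * ((2 ^ L ^ 2 + 2 * R + 2) * ((qr L - 1) ^ ql L) ^ 2) < qc L ^ (ql L + 1) ∧
    Nat.sqrt m ≤ m / qc L ^ (R + 1) ∧ (R + 1) * qc L ≤ Nat.sqrt m - 1 := by
  obtain ⟨E, hE⟩ : ∃ E, 6 * K + 14 = E := ⟨_, rfl⟩
  -- basic ranges
  have hL0 : L ≠ 0 := by
    rintro rfl
    rw [Nat.log_zero_right] at hKL
    omega
  have hm0 : m ≠ 0 := by
    rintro rfl
    rw [Nat.log_zero_right] at hLm
    exact hL0 hLm.symm
  have h2K : 2 ^ K ≤ L := hKL ▸ Nat.pow_log_le_self 2 hL0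
  have hLK : L < 2 ^ (K + 1) := hKL ▸ Nat.lt_pow_succ_log_self one_lt_two L
  have h2L : 2 ^ L ≤ m := hLm ▸ Nat.pow_log_le_self 2 hm0
  have hmL : m < 2 ^ (L + 1) := hLm ▸ Nat.lt_pow_succ_log_self one_lt_two m
  have hK9 : 2 ^ 9 ≤ 2 ^ K := Nat.pow_le_pow_right (by norm_num) hK
  have hL1 : 1 ≤ L := by omega
  have hE7 : E ≤ 7 * (K + 1) := by omega
  have hEL : 20 * E + 20 ≤ 3 * L := by have := forty_mul_add_le_two_pow hK; omega
  -- the parameters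
  have hr2 : 2 ≤ qr L := two_le_qr hL1
  have hlL : L ≤ ql L := by unfold ql; nlinarith [Nat.zero_le L]
  have hlr : ql L < qr L := ql_lt_qr L
  have hrc : qr L ≤ qc L := qr_le_qc L
  have hc2 : 2 ≤ qc L := hr2.trans hrc
  have hcE : qc L ≤ 2 ^ E := hE ▸ qc_le_two_pow hLK
  -- the budget: `2 (E R + E + 1) ≤ L`
  have hRL : R ≤ L := hRd ▸ Nat.div_le_self _ _
  have hER : E * R * 20 ≤ 7 * L :=
    calc E * R * 20 ≤ 7 * (K + 1) * R * 20 := by gcongr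
      _ = 7 * (20 * (K + 1) * (L / (20 * (K + 1)))) := by rw [hRd]; ring
      _ ≤ 7 * L := Nat.mul_le_mul_left 7 (Nat.mul_div_le L _)
  have h2X : 2 * (E * R + E + 1) ≤ L := by omega
  -- `2^X ≤ s`, `2 c^(R+1) ≤ 2^X`
  have hXs : 2 ^ (E * R + E + 1) ≤ Nat.sqrt m := by
    rw [Nat.le_sqrt, ← pow_add]
    exact le_trans (Nat.pow_le_pow_right (by norm_num) (by omega)) h2L
  have hcR1 : qc L ^ (R + 1) ≤ 2 ^ (E * R + E) :=
    calc qc L ^ (R + 1) ≤ (2 ^ E) ^ (R + 1) := Nat.pow_le_pow_left hcE _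
      _ = 2 ^ (E * R + E) := by rw [← pow_mul, mul_add_one]
  have hcRs : 2 * qc L ^ (R + 1) ≤ Nat.sqrt m := by
    refine le_trans ?_ hXs
    have h22 : 2 ^ (E * R + E + 1) = 2 * 2 ^ (E * R + E) := by rw [pow_succ, mul_comm]
    rw [h22]
    exact Nat.mul_le_mul_left 2 hcR1
  have hcpos : 0 < qc L ^ (R + 1) := Nat.pow_pos (by omega)
  have hcc : qc L ≤ qc L ^ (R + 1) := Nat.le_self_pow (by omega) _
  -- `T' = 2^{L²} + 2R + 2 ≤ 2^(L² + 1)`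
  have hT : 2 ^ L ^ 2 + 2 * R + 2 ≤ 2 ^ (L ^ 2 + 1) := by
    have h2 : 2 * R + 2 ≤ 2 ^ L ^ 2 :=
      calc 2 * R + 2 ≤ 2 ^ L * 2 := by have := @Nat.lt_two_pow_self L; omega
        _ = 2 ^ (L + 1) := (pow_succ 2 L).symm
        _ ≤ 2 ^ L ^ 2 := Nat.pow_le_pow_right (by norm_num) (by nlinarith)
    calc 2 ^ L ^ 2 + 2 * R + 2 ≤ 2 ^ L ^ 2 + 2 ^ L ^ 2 := by omega
      _ = 2 ^ (L ^ 2 + 1) := by ring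
  have hm1 : m + 1 ≤ 2 ^ (L + 1) := hmL
  refine ⟨hr2, by omega, by omega, ?_, ?_, ?_, ?_, ?_⟩
  · -- `4 (r - 1) ≤ 4 r²`
    unfold qc
    exact Nat.mul_le_mul_left 4
      (le_trans (Nat.sub_le (qr L) 1) (Nat.le_self_pow (by norm_num) (qr L)))
  · -- (A)
    have hexp : L ^ 2 + 1 + (L + 1) * ql L = qr L := by rw [qr]
    have h2l : 2 * ql L ^ 2 < qc L := by
      have := Nat.pow_lt_pow_left hlr (n := 2) (by norm_num)
      unfold qc; omega
    calc (2 ^ L ^ 2 + 2 * R + 2) * (m + 1) ^ ql L * (ql L ^ 2) ^ qr L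
        ≤ 2 ^ (L ^ 2 + 1) * (2 ^ (L + 1)) ^ ql L * (ql L ^ 2) ^ qr L := by gcongr
      _ = (2 * ql L ^ 2) ^ qr L := by rw [← pow_mul, ← pow_add, hexp, mul_pow]
      _ < qc L ^ qr L := Nat.pow_lt_pow_left h2l (by omega)
  · -- (B)
    have h1 : (qr L - 1) ^ ql L ≤ qr L ^ ql L :=
      Nat.pow_le_pow_left (Nat.sub_le (qr L) 1) (ql L)
    have h4 : 2 * 2 ^ (L ^ 2 + 1) ≤ 4 ^ (ql L + 1) := by
      rw [show (4 : ℕ) = 2 ^ 2 by norm_num, ← pow_mul, ← pow_succ']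
      refine Nat.pow_le_pow_right (by norm_num) ?_
      unfold ql
      omega
    have hr1 : 1 < qr L ^ 2 := Nat.one_lt_pow (by norm_num) (by omega)
    have hpos : 0 < 4 ^ (ql L + 1) * (qr L ^ ql L) ^ 2 := by positivity
    calc 2 * ((2 ^ L ^ 2 + 2 * R + 2) * ((qr L - 1) ^ ql L) ^ 2)
        ≤ 2 * (2 ^ (L ^ 2 + 1) * (qr L ^ ql L) ^ 2) := by gcongr
      _ = (2 * 2 ^ (L ^ 2 + 1)) * (qr L ^ ql L) ^ 2 := by ring
      _ ≤ 4 ^ (ql L + 1) * (qr L ^ ql L) ^ 2 := Nat.mul_le_mul_right _ h4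
      _ < 4 ^ (ql L + 1) * (qr L ^ ql L) ^ 2 * qr L ^ 2 :=
          lt_mul_of_one_lt_right hpos hr1
      _ = qc L ^ (ql L + 1) := by unfold qc; rw [mul_pow, ← pow_mul, ← pow_mul]; ring
  · -- live-set budget
    rw [Nat.le_div_iff_mul_le hcpos]
    calc Nat.sqrt m * qc L ^ (R + 1) ≤ Nat.sqrt m * Nat.sqrt m :=
          Nat.mul_le_mul_left _ (by omega)
      _ ≤ m := Nat.sqrt_le m
  · -- colour budget
    have h1 : (R + 1) * qc L ≤ qc L ^ (R + 1) :=
      Literature.Barriers.PneNP.succ_mul_le_pow_succ_of_two_le hc2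
    omega

/-- **T1q (PROVED).** At the same NOT budget, every `(⌊√m⌋-1, ⌊√m⌋)`-clique function needs
`2^{⌊log₂ m⌋²}` gates (quasi-polynomial form; eventually in `m`, no exponent parameter). -/
theorem cliqueLikeNegLimitedLogQuasi : ∀ᶠ m : ℕ in Filter.atTop, ∀ F : (KEdge m → Bool) → Bool,
    CliqueLike (univ : Finset (Fin m)) (Nat.sqrt m - 1) (Nat.sqrt m) F →
    ∀ C : Circuit (KEdge m), C.IsOver deMorganBasis → C.Computes F →
      C.negationCount ≤ logBudget m → 2 ^ (Nat.log 2 m) ^ 2 ≤ C.size := by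
  filter_upwards [Filter.eventually_ge_atTop (2 ^ 2 ^ 9)] with m hm F hCL C hC hcomp hneg
  have hL : 2 ^ 9 ≤ Nat.log 2 m := Nat.le_log_of_pow_le one_lt_two hm
  have hK : 9 ≤ Nat.log 2 (Nat.log 2 m) := Nat.le_log_of_pow_le one_lt_two hL
  have hRd : logBudget m = Nat.log 2 m / (20 * (Nat.log 2 (Nat.log 2 m) + 1)) := rfl
  obtain ⟨hr, hl, hls, h4, hA, hB, hsm, hRs⟩ := params_ok_quasi rfl rfl hRd hK
  exact le_size_of_cliqueLike_abN hr hl hls h4 hA hB hsm hRs F hCL C hC hcomp hneg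

/-! ### T3: the single-output negation-limited gap at NOT budget `Θ(log v / log log v)`

The shape of the tree's barrier record `Literature.Barriers.PneNP.NegationLimitedGapSingleOutputSqrtLog`
with `sqrtLogBudget` replaced by `logBudget`: the tree's `cliqueLike_generic_bound_gap` applied to the
discharged Tardos fact `Tardos1988_cliqueLike_polysize_holds` and T1. -/

/-- **T3**: a monotone, polynomial-size-computable family `T v : (KEdge v → Bool) → Bool` (Tardos's
function) such that, for every `k`, eventually every De Morgan circuit computing `T v` with at most
`logBudget v = ⌊log₂ v⌋ / (20 (⌊log₂ ⌊log₂ v⌋⌋ + 1))` NOT gates has at least `v ^ k` gates. -/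
theorem negationLimitedGapSingleOutputLog_holds :
    ∃ T : ∀ v : ℕ, (KEdge v → Bool) → Bool,
      (∀ v, Monotone (T v)) ∧
      (∃ K : ℕ, ∀ᶠ v : ℕ in Filter.atTop, ∃ C : Circuit (KEdge v),
          C.IsOver deMorganBasis ∧ C.Computes (T v) ∧ C.size ≤ v ^ K) ∧
      ∀ k : ℕ, ∀ᶠ v : ℕ in Filter.atTop, ∀ C : Circuit (KEdge v), C.IsOver deMorganBasis →
        C.Computes (T v) → C.negationCount ≤ logBudget v → v ^ k ≤ C.size :=
  Literature.Barriers.PneNP.cliqueLike_generic_bound_gap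
    Literature.Barriers.PneNP.Tardos1988_cliqueLike_polysize_holds cliqueLikeNegLimitedLog

end Summit.PneNP.PneNP.Theorems.NegLimLog
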